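import Literature.NumberTheory.EllipticCurves.TwoDescentKummerBridgeLocal
import Literature.NumberTheory.EllipticCurves.TwoDescentLocalGoodPlace
import HarnessLib

/-!
# Selmer classes have even valuation at the good odd places

Combining the local descent–Kummer bridge (`TwoDescentKummerBridgeLocal.lean`: at a completion `E`
of `K`, the global `T₁`-component `[a]` of a class `c ∈ H¹(K, E[2])` with `res_E c` in the local
Kummer condition is the descent component `x(P) - e₁` of a point `P ∈ E(E)`) with the valuation
parity of descent components at a good odd place (`TwoDescentLocalGoodPlace.lean`:
`OddPlace.exists_even_v_twoDescentComponent`), one gets the first half of Silverman's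
`Sel⁽²⁾ ⊆ K(S, 2) × K(S, 2)`: **at an odd place `v ∉ S` (`v(e₁ - e₂) = v(e₁ - e₃) = 0`) the global
component `a ∈ Kˣ` of a Selmer class has even valuation** (`even_v_of_res_mem`,
`even_v_of_mem_selmerGroup`). Stated for an abstract odd place `𝔳 : OddPlace E` on the completion
(for `E = ℚ_ℓ` the tree's `padicPlace ℓ`, `TwoDescentLocalPadic.lean`), so that the `S`-unit
conclusion over `ℚ` (`a ∈ ⟨-1, 2, p, q⟩ · ℚˣ²` for `E_{2pq}`) is a matter of bookkeeping at the
finitely many bad places. Theorems only; no named fact. Cell `bsd-monsky`.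

## References

* [SilvermanAEC2009] J. H. Silverman, *The Arithmetic of Elliptic Curves*, 2nd ed., GTM 106,
  Springer 2009, Prop. X.1.4, Prop. X.4.9 and Example X.4.10.
-/

noncomputable section

open scoped Classical

open Field Literature.NumberTheory.EllipticCurves.TwoDescentLocal WeierstrassCurve.Affine

universe u

namespace WeierstrassCurve

open Literature.NumberTheory.GaloisRepresentations Literature.NumberTheory.EllipticCurves

variable {K : Type u} [Field K] [CharZero K] (W : WeierstrassCurve K) [W.IsElliptic] {e₁ e₂ e₃ : K}
variable (E : Type u) [Field E] [Algebra K E] [CharZero E]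

omit [CharZero E] in
/-- **A square class of even valuation**: if `[u] = sqClass r` in `Eˣ/Eˣ²` with `v(r)` even, then
`v(u)` is even (`u = r s²`). [cite: SilvermanAEC2009, Prop. X.1.4] -/
theorem even_v_of_mk_eq_sqClass (𝔳 : OddPlace E) {u : Eˣ} {r : E} (hr : r ≠ 0)
    (h : (QuotientGroup.mk u : SqUnits E) = sqClass r) (hev : Even (𝔳.v r)) :
    Even (𝔳.v (u : E)) := by
  rw [sqClass_of_ne_zero hr, QuotientGroup.eq] at h
  obtain ⟨s, hs⟩ := h
  have hr' : r = (u : E) * ((s : E) ^ 2) := by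
    have := congrArg Units.val hs
    rw [powMonoidHom_apply, Units.val_pow_eq_pow_val, Units.val_mul, Units.val_inv_eq_inv_val,
      Units.val_mk0] at this
    rw [this]
    field_simp
  have hs0 : (s : E) ≠ 0 := s.ne_zero
  have hu0 : (u : E) ≠ 0 := u.ne_zero
  rw [hr', 𝔳.v_mul hu0 (pow_ne_zero 2 hs0), 𝔳.v_sq hs0] at hev
  obtain ⟨k, hk⟩ := hev
  exact ⟨k - 𝔳.v (s : E), by omega⟩

/-- **Selmer-type classes have even valuation at a good odd place** (Silverman AEC Prop. X.1.4,
the inclusion `δ(E(K_v)) ⊆ K_v(∅, 2)` for `v ∉ S`): let `𝔳` be an odd place of the `K`-field `E` with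
`v(e₁ - e₂) = v(e₁ - e₃) = 0` (good reduction at `v`). If `c ∈ H¹(K, E[2])` has `res_E c` in the local
Kummer condition and global `T₁`-component `[a]`, `a ∈ Kˣ`, then `v(a)` is even.
[cite: SilvermanAEC2009, Prop. X.1.4, Prop. X.4.9] -/
theorem even_v_of_res_mem (𝔳 : OddPlace E) (h : W.toAffine.SplitTwoTorsion e₁ e₂ e₃)
    [(W.baseChange E).IsElliptic]
    (hv₁₂ : 𝔳.v (algebraMap K E e₁ - algebraMap K E e₂) = 0)
    (hv₁₃ : 𝔳.v (algebraMap K E e₁ - algebraMap K E e₃) = 0) {c : galH1Torsion W 2}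
    (hc : galoisCohomology.res (W.torsionGaloisModule 2) E 1 c ∈ W.kummerLocalConditionAt 2 E)
    (a : Kˣ) (ha : kummerEquiv K 2 (W.twoTorsionCharH1 h c) = Additive.ofMul (QuotientGroup.mk a)) :
    Even (𝔳.v (algebraMap K E (a : K))) := by
  obtain ⟨P, hP⟩ := W.exists_twoDescentComponent_eq_of_res_mem E h hc a ha
  obtain ⟨r, hr, hPr, hev⟩ := 𝔳.exists_even_v_twoDescentComponent (h.map E) hv₁₂ hv₁₃ P
  have hmk : (QuotientGroup.mk (Units.map (algebraMap K E : K →* E) a) : SqUnits E) = sqClass r := by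
    rw [← hP, hPr]
  have := even_v_of_mk_eq_sqClass E 𝔳 hr hmk hev
  rwa [Units.coe_map, MonoidHom.coe_coe] at this

/-- **Selmer classes have even valuation at the good odd places** (number field `K`, place `v`,
odd place `𝔳` of `K_v` with `v(e₁ - e₂) = v(e₁ - e₃) = 0`): for `c ∈ Sel⁽²⁾(E/K)` with global
`T₁`-component `[a]`, `v(a)` is even. [cite: SilvermanAEC2009, Prop. X.1.4, Prop. X.4.9] -/
theorem even_v_of_mem_selmerGroup [NumberField K] (h : W.toAffine.SplitTwoTorsion e₁ e₂ e₃)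
    {c : galH1Torsion W 2} (hc : c ∈ selmerGroup W 2) (v : NumberField.Place K)
    [CharZero (NumberField.Place.Completion v)]
    [(W.baseChange (NumberField.Place.Completion v)).IsElliptic]
    (𝔳 : OddPlace (NumberField.Place.Completion v))
    (hv₁₂ : 𝔳.v (algebraMap K (NumberField.Place.Completion v) e₁ -
      algebraMap K (NumberField.Place.Completion v) e₂) = 0)
    (hv₁₃ : 𝔳.v (algebraMap K (NumberField.Place.Completion v) e₁ -
      algebraMap K (NumberField.Place.Completion v) e₃) = 0)
    (a : Kˣ) (ha : kummerEquiv K 2 (W.twoTorsionCharH1 h c) = Additive.ofMul (QuotientGroup.mk a)) :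
    Even (𝔳.v (algebraMap K (NumberField.Place.Completion v) (a : K))) :=
  W.even_v_of_res_mem (NumberField.Place.Completion v) 𝔳 h hv₁₂ hv₁₃
    ((W.mem_selmerGroup_iff_forall_localization_mem 2 c).mp hc v) a ha

end WeierstrassCurve

end
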